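/-
Copyright: publication-cell `pub-balaban` (b2b), seat b2b-balaban-b10 gen 22 (v1).  Literature leaf — linear algebra
of `n × n` complex matrices (matrix units, trace, `U(n) = U(1)·SU(n)`), one-line applications of the lineage's joint
theorems, and `2 × 2` arithmetic only; every theorem is kernel-proved and tagged [folklore] or [cite: …] (a LOCATED
printed shape); the objects are the MODEL OBJECTS of `…B10Eq29TubeLine` / `…B10Eq61Leaves` / `…B10Eq31GlobalConj`
(`Tube`, `TubeCfg`, `expLine`, `commSpan`), never asserted to be Bałaban's; NO new cited facts, NO new quotation,
NO summit vocabulary.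
-/
import Mathlib
import Literature.MathematicalPhysics.QuantumFieldTheory.Balaban1983to89.B10Eq31GlobalConj
import Literature.MathematicalPhysics.QuantumFieldTheory.Balaban1983to89.B13DerivZeroGauge

/-!
# `Balaban1983to89.B10Eq32SuN` — [Balaban1985UV3] (31)–(32) p. 264 FOR `G = SU(N)`, GENERAL `N`, in the
# C⋆-algebra model: the detected span `span_ℂ [𝔰𝔲(N), M_N(ℂ)] = 𝔰𝔩_N = commSpan M_N(ℂ)` (the centre `𝔲(1)` is
# invisible; `N = 1` detects nothing), `SU(N)`-class functions ARE `U(N)`-class functions, the lineage's joint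
# theorems in `G`-FORM (finite-dimensional complex semisimple `𝔥 ⊆ 𝔸`, via b13's `B13DerivZeroGauge` §3b BY NAME)
# and in `SU(N)`-FORM (invariance under `SU(N)` + traceless generators), and a TRUE `B13.Consts` R21-instance of
# the [II]-letter theorem over `M₂(ℂ)` whose differenced family is `−4 ≠ 0`

T. Bałaban, *Ultraviolet stability of three-dimensional lattice pure gauge field theories*, Commun. Math. Phys. **102**,
255–275 (1985) [Balaban1985UV3] (cell paper B10; PDF `paper:balaban1985-cmp102-uv-stability-3d`, journal page = PDF
page + 254); T. Bałaban, *Renormalization group approach to lattice gauge field theories. I*, Commun. Math. Phys.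
**109**, 249–301 (1987) [Balaban1987RG1] = [I]; *… II*, Commun. Math. Phys. **116**, 1–22 (1988)
[Balaban1988RG2Cluster] = [II].  All quotations in §0 are RE-KEYED byte-for-byte from the §0 of the tree module
`…B10Eq31GlobalConj` (v1, b10 gen 21; themselves re-keyed from `…B13DerivZeroGauge` §0 v1.1 / `…B10Eq29CplxLine` §0
v1, renders `1985-cmp102-uv-stability-3d-p009`, `-p010`, `-p018`, `1987-cmp109-rg-I-small-field-p014-x2`, `-p015`,
`-p035`, `1988-cmp116-rg-II-cluster-p021`, `-p022` READ AS IMAGES there); this module adds NO new quotation and NO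
cited fact.  Siblings (imported BY NAME, byte-identical, nothing edited): `…B10Eq31GlobalConj` (hence
`…B10Eq29CplxLine`, `…B10Eq61Leaves`, `…B10Eq29TubeLine`, `…B10Eq61PerSite`): `TubeCfg`, `expLine`, `diffAlongV`,
`commSpan`, `comm_mem_commSpan`, the six joint theorems `logHalfBound_expLine(_cplx)_of_flowInvariant/_of_classFn`,
`bound118_secondOrder_expLine_cplx_of_flowInvariant/_of_classFn`, the `M₂(ℂ)` data `M₂`, `trCLM`, `mA = E₁₂`, `mC`,
`mK = [A, C] = diag(iπ, −iπ)`, `m2E = tr`, `example_logHalfBound_m2E`, `exp_mK_add_smul_mA`, `norm_mA_le`,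
`m2E_conj`; and b13's `…B13DerivZeroGauge` (v1.2, b13 gen 17): `mem_closure_span_comm_of_mem` (§3b).

WHY THIS MODULE (the b10 lineage's open edge after `B10Eq31GlobalConj` v1: cell GAPS C-b10g21-1 HONEST SCOPE (iv) /
(viii), README gen 21 «How to continue (gen 22)» nodes 3 + 1; b13's XREAD-REQUEST on `B13DerivZeroGauge` v1.2).
`B10Eq31GlobalConj` discharged the symmetry binders of the lineage's join theorems from two printed ingredients of
p. 264 — (31) *"The gauge invariance (26) implies the invariance with respect to the global transformations R(U),
U ∈ G"* and (32) *"by the assumption that 𝔤 is semi-simple, the only element invariant is 0"* — in two forms: a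
FLOW FORM for an arbitrary family of generators `Y : Λ → 𝔸` and a CLASS-FUNCTION FORM for ALL unitaries of `𝔸`;
the detected span was identified only for `𝔸 = M₂(ℂ)` and all of `U(2)` (`coe_commSpan_m2`: `𝔰𝔩₂`), and the Lie
bridge for a subgroup `G ⊊ U(N)` was deferred (HONEST SCOPE (iv) there).  The paper's `G` is a compact SEMISIMPLE
group — for matrices: `SU(N)`, not `U(N)` — so this module does (31)–(32) for `G = SU(N)` and general `N`:
(§1) [folklore] THE DETECTED SPAN FOR `SU(n)` (any finite index type `n`): `span_ℂ {[S, y] : S ∈ 𝔰𝔲(n),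
y ∈ M_n(ℂ)} = 𝔰𝔩_n`, the traceless matrices (`span_suComm_eq_ker_trace`; matrix units: `E_ij = −(i/2)·[i(E_ii −
E_jj), E_ij]`, `E_ii − E_jj = [E_ij − E_ji, E_ji]`, and `P = Σ_{i≠j} P_ij E_ij + Σ_i P_ii(E_ii − E_{j₀j₀}) +
(tr P)E_{j₀j₀}`) — so the compact semisimple `SU(n)` detects exactly what all of `U(n)` detects
(`commSpan_matrix_eq_span_suComm`, `coe_commSpan_matrix`: the model's `commSpan M_N(ℂ)` IS `𝔰𝔩_N` for every
`N`), the centre `ℂ·1 = 𝔲(1)ᶜ` is invisible (`one_not_mem_span_suComm`, `one_not_mem_commSpan_matrix`), and for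
`n` a singleton (`G = U(1)`, the abelian case the paper excludes) NOTHING is detected
(`span_suComm_eq_bot_of_card_eq_one`, `commSpan_matrix_one_eq_bot`) — *"It is the only place we use the
semi-simplicity"*; this is the conclusion of b13's `B13DerivZeroGauge.lieSubalgebra_le_span_comm` for `𝔥 = 𝔰𝔩_n`,
`λ` ranging over `𝔰𝔲(n)`, obtained here by matrix units WITHOUT Cartan's criterion (Mathlib has no
`LieAlgebra.IsSemisimple` instance for `𝔰𝔩_n`), together with the two instance assumptions of `B13DerivZeroGauge`
HONEST SCOPE (vii) made concrete for `𝔤 = 𝔰𝔲(n)` (§1c: `𝔰𝔲(n) ∩ i𝔰𝔲(n) = 0`, `eq_zero_of_skew_of_I_smul_skew`;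
`span_ℂ 𝔰𝔲(n) = 𝔰𝔩_n`, `span_su_eq_ker_trace`).  (§2) [folklore] `U(n) = U(1)·SU(n)` AT THE LEVEL OF
CONJUGATIONS: for `W ∈ U(n)` the special unitary `W′ = μ̄W` (`μ^|n| = det W`, `|μ| = 1`; ℂ algebraically closed)
conjugates exactly as `W` does (`exists_specialUnitary_conj_eq`), so an `SU(n)`-CLASS FUNCTION on any set of bond
configurations IS a `U(n)`-CLASS FUNCTION (`classFn_of_suClassFn`): (26) for the constant gauge transformations with
values in `G = SU(n)` is all that the lineage's class-function form asks.  (§3) THE JOINT THEOREMS IN `G`-FORM: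
`B10Eq31GlobalConj.…_of_flowInvariant` with the commutator binder `hcomm` DISCHARGED by b13's
`B13DerivZeroGauge.mem_closure_span_comm_of_mem` (its set is, with `Y l := (λ l : 𝔸)`, literally the binder's
set): for a finite-dimensional complex semisimple Lie subalgebra `𝔥 ⊆ 𝔸` (commutator bracket; the realised `𝔤ᶜ`),
a family `λ : Λ → 𝔥` spanning `𝔥` over ℂ, flows `Ad exp(tλ_l)` leaving every `E X` invariant on the bondwise tube,
and bond generators `𝔥`-valued — `logHalfBound_expLine_cplx_of_semisimple`,
`bound118_secondOrder_expLine_cplx_of_semisimple`, `logHalfBound_expLine_of_semisimple`.  (§4) THE JOINT THEOREMS IN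
`SU(N)`-FORM over `M_N(ℂ)`
(operator norm, `cstarAlgebraMatrix N` by `letI`): invariance of `E X` on the bondwise tube under the conjugations by
`W ∈ SU(N)` (class-function form) or by `exp(tS)`, `S ∈ 𝔰𝔲(N)`, `t ∈ ℝ` (flow form), and bond generators
TRACELESS (skew part in `𝔰𝔲(N)` by (27), complex part in `𝔰𝔩_N = 𝔰𝔲(N)ᶜ` by [I] (1.13) / p. 283) —
`logHalfBound_expLine_cplx_of_suClassFn` / `_of_suFlowInvariant`, `bound118_secondOrder_expLine_cplx_of_suClassFn`,
`logHalfBound_expLine_of_suClassFn`.  (§5) A TRUE R21-INSTANCE (README gen 21 node 1): `r21Consts` — [II]'s letters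
with `L = 13`, `M = 2`, `α₀ = α₁ = α₄ = γ₂ = (LM)⁻⁴ = 1/456976` (`r21Consts_R21`: the printed restriction R21 holds,
with equality) — and EVERY binder of `bound118_secondOrder_expLine_cplx_of_suClassFn` DERIVED for the `M₂(ℂ)` data
with `G = SU(2)`: generator `K + α₁E₁₂` (traceless; complex part of size exactly `α₁`, not skew, not commuting with
`K`), `A = 3‖tr‖/(LM)⁴` (so that `A(LM)⁴ = 3‖tr‖` is `B10Eq61Leaves.example_logHalfBound_m2E`), tube half-width
`a = 1`, `c₀ = ‖K‖(LM)³`, `c₁ = 1`, `r = 0` (`example_bound118_expLine_cplx_m2_R21`), with the differenced family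
at `1` EQUAL TO `tr exp(K + α₁E₁₂) − tr 1 = −4` (`example_diffAlongV_m2_R21`, by `B10Eq31GlobalConj.exp_mK_add_smul_mA`).

CITATION HEADER (lean-in-tree rule).  WHAT IS REPRODUCED (verbatim, §0): [Balaban1985UV3] p. 263 ((26), (29)),
p. 264 ((31)–(32) with the semi-simplicity sentence), p. 272 (the cancellation at `U_{k+1} = 1`); [Balaban1987RG1]
p. 262 ((1.11)–(1.13)), p. 263 ((1.19)), p. 283 (Gᶜ-invariance implied by G-invariance); [Balaban1988RG2Cluster]
pp. 21–22 — all already in `B10Eq31GlobalConj` §0 (v1) (and before it in `B13DerivZeroGauge` §0 v1.1 /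
`B10Eq29CplxLine` §0 v1); this module adds NO quotation and NO cited fact.  The R21 sentence of [II] p. 20 is quoted in
`B13.Consts.R21`'s docstring (b13 lineage), not here.

WHAT IS KERNEL-CERTIFIED (linear algebra of matrix units and of `U(n)`, one-line applications of the lineage's
theorems, `2 × 2` arithmetic — no object of the papers is constructed):
* §1 [folklore] — `suComm n = {[S, y] : S⋆ = −S, tr S = 0}` (`suComm_eq`), `span_suComm_le_ker_trace`,
  `star_I_smul_single_sub_single` / `trace_I_smul_single_sub_single` (`i(E_ii − E_jj) ∈ 𝔰𝔲(n)`),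
  `star_single_sub_single` / `trace_single_sub_single` (`E_ij − E_ji ∈ 𝔰𝔲(n)`), `I_smul_single_sub_single_comm`
  (`[i(E_ii − E_jj), E_ij] = 2iE_ij`), `single_sub_single_comm` (`[E_ij − E_ji, E_ji] = E_ii − E_jj`),
  `single_mem_span_suComm`, `single_sub_single_mem_span_suComm`, `mem_span_suComm_of_trace_eq_zero`,
  `span_suComm_eq_ker_trace` / `coe_span_suComm` (**`span_ℂ [𝔰𝔲(n), M_n(ℂ)] = 𝔰𝔩_n`**), `one_not_mem_span_suComm`,
  `span_suComm_eq_bot_of_card_eq_one`; §1b (`cstarAlgebraMatrix N` by `letI`): `span_suComm_le_commSpan`,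
  `commSpan_matrix_le_ker_trace`, `commSpan_matrix_eq_span_suComm`, `coe_commSpan_matrix` (**`commSpan M_N(ℂ) = 𝔰𝔩_N`**,
  all `N`), `one_not_mem_commSpan_matrix`, `commSpan_matrix_one_eq_bot`; §1c: `su n`, `eq_zero_of_skew_of_I_smul_skew`,
  `mem_span_su_of_trace_eq_zero`, `span_su_eq_ker_trace` (`span_ℂ 𝔰𝔲(n) = 𝔰𝔩_n`).
* §2 [folklore] — `exists_specialUnitary_conj_eq` (`IsAlgClosed.exists_pow_nat_eq`, `Matrix.det_of_mem_unitary`,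
  `Matrix.det_smul`), `classFn_of_suClassFn`.
* §3 — `logHalfBound_expLine_cplx_of_semisimple`, `bound118_secondOrder_expLine_cplx_of_semisimple`,
  `logHalfBound_expLine_of_semisimple` (section-local `LieRing.ofAssociativeRing` /
  `LieAlgebra.ofAssociativeAlgebra`, Mathlib's idiom as in `B13DerivZeroGauge` §3b; nothing registered).
* §4 — `mem_closure_commSpan_of_trace_eq_zero`, `mem_closure_span_suFlow_of_trace_eq_zero`,
  `logHalfBound_expLine_cplx_of_suClassFn`, `logHalfBound_expLine_cplx_of_suFlowInvariant`,
  `bound118_secondOrder_expLine_cplx_of_suClassFn`, `logHalfBound_expLine_of_suClassFn`.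
* §5 — `r21Consts`, `r21Consts_LM` (`LM = 26`), `r21Consts_R21`, `m2GenR = K + E₁₂/456976`, `trace_mK`, `trace_mA`,
  `trace_m2GenR`, `m2GenR_split`, `m2E_suClassFn`, `example_bound118_expLine_cplx_m2_R21`, `example_diffAlongV_m2_R21`.

HONEST SCOPE.  (i) MODEL, NOT THE PAPER'S OBJECTS — as `…B10Eq29TubeLine` / `…B10Eq31GlobalConj` HONEST SCOPE (i):
one bond = one unital C⋆-algebra (here also `M_N(ℂ)` with the operator norm), the tube `{exp(B)·U}`, none of the
derivative / averaging conditions of [5] (3.35)–(3.37), [I] (i)–(iii).  (ii) CONSTANT gauge transformations only and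
BASE POINT `1` only, as in `B10Eq31GlobalConj` HONEST SCOPE (ii)–(iii).  (iii) WHAT IS DETECTED BY `SU(N)`: `𝔰𝔩_N`,
the same as by `U(N)`; a bond generator with a non-zero TRACE PART (`𝔲(N)`-valued `𝓗(B)`, `G = U(N)`) is outside
every theorem here, in accordance with the printed hypothesis that `G` is semisimple; `N = 1` detects nothing.  (iv) §3 is
ABSTRACT: it needs `𝔥` to carry Mathlib's `LieAlgebra.IsSemisimple ℂ` for the commutator bracket and `λ` to ℂ-span
`𝔥`; for `G = SU(N)` the CONCRETE route is §4 (whose content, `[𝔰𝔲(N), M_N(ℂ)] = 𝔰𝔩_N`, is what §3 would give for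
`𝔥 = 𝔰𝔩_N` granted semisimplicity of `𝔰𝔩_N`, `N ≥ 2`, which is not available in Mathlib and not proved here); for
the flows of §3 with NON-skew `λ_l` the hypothesis `hcl` is `Gᶜ`-invariance, strictly stronger than (26) for
`G`-valued `u` (cell GAPS C-B13-37 reading note, witness `classFn_not_conjInvariant` there) — instantiate `λ` by
skew elements (a basis of the real form `𝔤`); the `𝔤ᶜ` directions enter on the GENERATOR side.  (v) The `SU(N)` flow
form asks invariance under `exp(tS)`, `S ∈ 𝔰𝔲(N)`; that these exhaust `SU(N)` (surjectivity of `exp`, `det exp =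
exp tr`) is neither needed nor proved; the class-function form asks invariance under `SU(N)` directly and reduces to
`U(N)` by §2.  (vi) For the ACTUAL localized (61)/(63)-pieces, their invariance (26), the per-bond membership
`𝓗(B)_b ∈ 𝔤` (resp. `A′ ∈ 𝔤ᶜ`), the undifferenced bound, the volume bound, `A`, `a`, `c₀`, `c₁` are HYPOTHESES (cell
GAPS C-B13-32 / C-adv2-63 R1 / C-b10g19-2 (iii)), unchanged.  (vii) THE NUMBERS OF §5 ARE THE MODEL'S: `L = 13`, `M = 2`
and the `α`'s are chosen ONLY so that the printed restriction R21 holds (no other printed restriction on [II]'s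
constants — `R24`, the size of `M`, of `κ`, … — is claimed for `r21Consts`); the example's real part has `‖K‖ = π
= O(1)`, so the letters are met with the LARGE `c₀ = ‖K‖(LM)³` — the theorem leaves `c₀` free and the instance
exercises its letters, it does NOT sit in the paper's small-field regime `|Re| ≲ (LM)Bα₀`; the complex part has size
exactly `α₁ = (LM)⁻⁴`; the differenced family is computed exactly (`−4`), so the bound is not met vacuously.  (viii) The
module is NOT a proof of (24), (61)–(63), (I.1.18) or Theorem 2, and NOT summit progress.  (ix) Not done here (README
gen 21 nodes 2, 4–7): the located `hcls`/`hcomm` for the printed pieces over the `B10Eq24Cumulant` interfaces, the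
two-regime re-join, the other compact semisimple `G` (`SO(N)`, `Sp(N)`: their detected spans inside `M_N(ℂ)`).

## §0. The printed sentences (verbatim; all already in `B10Eq31GlobalConj` §0 (v1), re-keyed byte-for-byte from
there; read off the renders by b13 gens 10–16 / b10 gens 17–20; nothing new)

[Balaban1985UV3] = T. Bałaban, *Ultraviolet stability of three-dimensional lattice pure gauge field theories*, Commun.
Math. Phys. **102** (1985) 255–275.
* p. 263 (render `1985-cmp102-uv-stability-3d-p009`): *"equalities hold 𝒫′₁(g₀, X, U₁^𝓊) = 𝒫′₁(g₀, X, U₁), (26) for all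
  gauge transformations 𝓊. The second is a localization property with respect to U₁. … The third property is the
  analyticity with respect to U₁. These properties follow from the results of previous papers"*; *"By the gauge
  invariance (26), we have 𝒫′₁(g₀, X, U₁) = 𝒫′₁(g₀, X, exp i𝓗(B)), (29) and we expand the function with respect to
  𝓗(B)."*
* p. 264 (render `…-p010`): *"The gauge invariance (26) implies the invariance with respect to the global transformations
  R(U), U ∈ G, hence the equality R(U)((δ/δ𝓗(b))𝒫′₁)(g₀, X, 1) = ((δ/δ𝓗(b))𝒫′₁)(g₀, X, 1). (31) We have to notice
  only that (26) holds for all regular gauge field configurations, not only for the minimal configurations U₁. The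
  derivative in the above formula is an element of the Lie algebra 𝔤, and by the assumption that 𝔤 is semi-simple, the
  only element invariant is 0, and we conclude ((δ/δ𝓗(b))𝒫′₁)(g₀, X, 1) = 0. (32) It is the only place we use the
  semi-simplicity, but the above conclusion is a fundamental point in our method. In the renormalization group language
  it is the statement that there are no relevant variables in the effective action."*
* p. 272 (render `…-p018`, after (63)): *"Now let us notice that gathering
  together the first terms in the expansions (30) we obtain the expansion of (63) for the external field U_{k+1} = 1.
  This is cancelled by the second term in (61), and we obtain the desired expansion."*

[Balaban1987RG1] p. 262: *"(i) 𝐔 = U′U, U has values in the group G, |∂U − 1| < α₀ξ² on X, (1.11) for each cube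
□ ⊂ X of a size O(1)LM there exists a G-valued gauge transformation u defined on □ and such, that Uᵘ = exp iξA, |A|,
|∇^ξA| < O(1)LMBα₀ on □, (1.12) with a sufficiently large constant B (it will be determined later). (ii) U′ =
exp iξA′, A′ has values in the algebra gᶜ, |A′|, |∇^ξ_U A′| < α₁ on X. (1.13)"*
[Balaban1987RG1] p. 263 (render `1987-cmp109-rg-I-small-field-p015`): *"The most important is
  gauge invariance. We assume that all functions 𝐄⁽ʲ⁾(X, g_{j−1}, 𝐔, 𝐉) are gauge invariant with respect to the group
  of all gauge transformations (1.10). Explicitly 𝐄⁽ʲ⁾(X, g_{j−1}, 𝐔ᵘ, R(u)𝐉) = 𝐄⁽ʲ⁾(X, g_{j−1}, 𝐔, 𝐉) (1.19) for all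
  Gᶜ-valued gauge transformations u. The spaces Uᶜ_j(X, α₀, α₁) are, by the definition, gauge invariant also."*
[Balaban1987RG1] p. 283 (render `…-p035`): *"We assume the gauge invariance with respect to Gᶜ-valued gauge transformations, but it is
  implied by the invariance with respect to G-valued transformations, and by the analyticity of the function, as it was
  noticed already."*

[Balaban1988RG2Cluster] p. 21, last paragraph (running on to p. 22; renders `1988-cmp116-rg-II-cluster-p021`,
`…-p022`): *"the expressions (2.14) are gauge invariant with respect to all G-valued transformations. The
expressions are analytic functions of (U,J), hence the invariance can be extended, by the analyticity, to Gᶜ-valued gauge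
transformations in a small neighborhood of the space of G-valued ones."* — and: *"This means that the expressions are constant on intersections of orbits with the
corresponding space of configurations (𝐔, 𝐉) satisfying the conditions I.(i)–(iv). We extend them to constant functions
on whole orbits having non-empty intersections with the space. The above remark completes the proof of the inductive
assumptions for the action A_{k+1}, hence the proof of Theorem I.3."*
-/


noncomputable section

open Metric Set NormedSpace
open scoped Topology

namespace Literature.MathematicalPhysics.QuantumFieldTheory.Balaban1983to89.B10Eq32SuN

open B10Eq61PerSite (diffAlongV unitSys)
open B10Eq29TubeLine (TubeCfg expLine cstarAlgebraMatrix)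
open B10Eq31GlobalConj (commSpan comm_mem_commSpan logHalfBound_expLine_cplx_of_flowInvariant
  bound118_secondOrder_expLine_cplx_of_flowInvariant logHalfBound_expLine_of_flowInvariant
  logHalfBound_expLine_cplx_of_classFn bound118_secondOrder_expLine_cplx_of_classFn
  logHalfBound_expLine_of_classFn)

/-! ## §1. [folklore] `𝔰𝔩_n = [𝔰𝔲(n), M_n(ℂ)]`: the detected span for `G = SU(n)` (and `U(n)`) is the traceless
matrices -/

section slN

open Matrix

variable {n : Type*} [Fintype n] [DecidableEq n]

variable (n) in
/-- The commutators `[S, y] = S·y − y·S` with `S ∈ 𝔰𝔲(n)` (skew-Hermitian AND traceless) and `y ∈ M_n(ℂ)` arbitrary: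
the directions detected by the one-parameter groups of the constant gauge transformations with values in `SU(n)`.
[folklore] -/
def suComm : Set (Matrix n n ℂ) :=
  {P | ∃ S y : Matrix n n ℂ, star S = -S ∧ Matrix.trace S = 0 ∧ P = S * y - y * S}

omit [DecidableEq n] in
/-- A commutator is traceless: `span_ℂ [𝔰𝔲(n), M_n(ℂ)] ⊆ 𝔰𝔩_n`. [folklore] -/
theorem span_suComm_le_ker_trace :
    Submodule.span ℂ (suComm n) ≤ LinearMap.ker (Matrix.traceLinearMap n ℂ ℂ) := by
  refine Submodule.span_le.2 ?_
  rintro _ ⟨S, y, -, -, rfl⟩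
  simp [Matrix.trace_mul_comm S y]

omit [Fintype n] in
/-- `i(E_ii − E_jj) ∈ 𝔰𝔲(n)`: skew-Hermitian. [folklore] -/
theorem star_I_smul_single_sub_single (i j : n) :
    star (Complex.I • (single i i (1 : ℂ) - single j j 1)) = -(Complex.I • (single i i (1 : ℂ) - single j j 1)) := by
  rw [star_smul, star_sub, star_eq_conjTranspose, star_eq_conjTranspose, conjTranspose_single,
    conjTranspose_single, star_one, Complex.star_def, Complex.conj_I, neg_smul]

/-- `i(E_ii − E_jj) ∈ 𝔰𝔲(n)`: traceless. [folklore] -/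
theorem trace_I_smul_single_sub_single (i j : n) :
    Matrix.trace (Complex.I • (single i i (1 : ℂ) - single j j 1)) = 0 := by
  rw [trace_smul, trace_sub, trace_single_eq_same, trace_single_eq_same, sub_self, smul_zero]

omit [Fintype n] in
/-- `E_ij − E_ji ∈ 𝔰𝔬(n) ⊆ 𝔰𝔲(n)`: skew-Hermitian. [folklore] -/
theorem star_single_sub_single (i j : n) :
    star (single i j (1 : ℂ) - single j i 1) = -(single i j (1 : ℂ) - single j i 1) := by
  rw [star_sub, star_eq_conjTranspose, star_eq_conjTranspose, conjTranspose_single, conjTranspose_single,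
    star_one, neg_sub]

/-- `E_ij − E_ji` is traceless for `i ≠ j`. [folklore] -/
theorem trace_single_sub_single {i j : n} (hij : i ≠ j) :
    Matrix.trace (single i j (1 : ℂ) - single j i 1) = 0 := by
  rw [trace_sub, trace_single_eq_of_ne i j _ hij, trace_single_eq_of_ne j i _ hij.symm, sub_self]

/-- `[i(E_ii − E_jj), E_ij] = 2i·E_ij` for `i ≠ j`. [folklore] -/
theorem I_smul_single_sub_single_comm {i j : n} (hij : i ≠ j) (c : ℂ) :
    Complex.I • (single i i (1 : ℂ) - single j j 1) * single i j c
      - single i j c * (Complex.I • (single i i (1 : ℂ) - single j j 1)) = (2 * Complex.I) • single i j c := by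
  have h1 : (single i i (1 : ℂ) - single j j 1) * single i j c = single i j c := by
    rw [sub_mul, single_mul_single_same, one_mul, single_mul_single_of_ne (h := hij.symm), sub_zero]
  have h2 : single i j c * (single i i (1 : ℂ) - single j j 1) = -single i j c := by
    rw [mul_sub, single_mul_single_of_ne (h := hij.symm), single_mul_single_same, mul_one, zero_sub]
  rw [smul_mul_assoc, mul_smul_comm, h1, h2, ← smul_sub, sub_neg_eq_add, ← two_smul ℂ, smul_smul,
    mul_comm]

/-- `[E_ij − E_ji, E_ji] = E_ii − E_jj` for `i ≠ j` (scaled by `c`). [folklore] -/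
theorem single_sub_single_comm {i j : n} (hij : i ≠ j) (c : ℂ) :
    (single i j (1 : ℂ) - single j i 1) * single j i c - single j i c * (single i j (1 : ℂ) - single j i 1)
      = single i i c - single j j c := by
  rw [sub_mul, mul_sub, single_mul_single_same, single_mul_single_of_ne (h := hij), single_mul_single_same,
    single_mul_single_of_ne (h := hij), one_mul, mul_one, sub_zero, sub_zero]

/-- **Off-diagonal matrix units are detected**: `E_ij = −(i/2)·[i(E_ii − E_jj), E_ij] ∈ span_ℂ [𝔰𝔲(n), M_n(ℂ)]`
(`i ≠ j`). [folklore] -/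
theorem single_mem_span_suComm {i j : n} (hij : i ≠ j) (c : ℂ) :
    single i j c ∈ Submodule.span ℂ (suComm n) := by
  have hmem : Complex.I • (single i i (1 : ℂ) - single j j 1) * single i j c
      - single i j c * (Complex.I • (single i i (1 : ℂ) - single j j 1)) ∈ Submodule.span ℂ (suComm n) :=
    Submodule.subset_span ⟨_, single i j c, star_I_smul_single_sub_single i j,
      trace_I_smul_single_sub_single i j, rfl⟩
  rw [I_smul_single_sub_single_comm hij] at hmem
  have h := Submodule.smul_mem _ (2 * Complex.I)⁻¹ hmem
  rwa [smul_smul, inv_mul_cancel₀ (mul_ne_zero two_ne_zero Complex.I_ne_zero), one_smul] at h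

/-- **Differences of diagonal matrix units are detected**: `E_ii − E_jj = [E_ij − E_ji, E_ji] ∈
span_ℂ [𝔰𝔲(n), M_n(ℂ)]` (`i ≠ j`). [folklore] -/
theorem single_sub_single_mem_span_suComm {i j : n} (hij : i ≠ j) (c : ℂ) :
    single i i c - single j j c ∈ Submodule.span ℂ (suComm n) := by
  rw [← single_sub_single_comm hij c]
  exact Submodule.subset_span ⟨_, single j i c, star_single_sub_single i j, trace_single_sub_single hij, rfl⟩

/-- **Every traceless matrix is detected by `SU(n)`**: `𝔰𝔩_n ⊆ span_ℂ [𝔰𝔲(n), M_n(ℂ)]`.  Decompose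
`P = Σ_{i ≠ j} P_ij E_ij + Σ_i P_ii (E_ii − E_{j₀j₀}) + (tr P)·E_{j₀j₀}`. [folklore] -/
theorem mem_span_suComm_of_trace_eq_zero {P : Matrix n n ℂ} (hP : Matrix.trace P = 0) :
    P ∈ Submodule.span ℂ (suComm n) := by
  rcases isEmpty_or_nonempty n with hn | ⟨⟨j₀⟩⟩
  · rw [Subsingleton.elim P 0]
    exact Submodule.zero_mem _
  · have key : ∀ i j, single i j (P i j) - (if i = j then single j₀ j₀ (P i j) else 0)
        ∈ Submodule.span ℂ (suComm n) := by
      intro i j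
      by_cases hij : i = j
      · subst hij
        rw [if_pos rfl]
        by_cases hi : i = j₀
        · subst hi
          rw [sub_self]
          exact Submodule.zero_mem _
        · exact single_sub_single_mem_span_suComm hi _
      · rw [if_neg hij, sub_zero]
        exact single_mem_span_suComm hij _
    have hdiag : ∑ i, ∑ j, (if i = j then single j₀ j₀ (P i j) else 0) = (0 : Matrix n n ℂ) :=
      calc ∑ i, ∑ j, (if i = j then single j₀ j₀ (P i j) else 0) = ∑ i, single j₀ j₀ (P i i) :=
            Finset.sum_congr rfl fun i _ => Fintype.sum_ite_eq i fun j => single j₀ j₀ (P i j)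
        _ = single j₀ j₀ (∑ i, P i i) := (map_sum (singleAddMonoidHom j₀ j₀) (fun i => P i i) Finset.univ).symm
        _ = 0 := by
            change single j₀ j₀ (Matrix.trace P) = 0
            rw [hP, single_zero]
    have hdec : P = ∑ i, ∑ j, (single i j (P i j) - (if i = j then single j₀ j₀ (P i j) else 0))
        + ∑ i, ∑ j, (if i = j then single j₀ j₀ (P i j) else 0) := by
      rw [← Finset.sum_add_distrib]
      simp_rw [← Finset.sum_add_distrib, sub_add_cancel]
      exact matrix_eq_sum_single P
    rw [hdec, hdiag, add_zero]
    exact Submodule.sum_mem _ fun i _ => Submodule.sum_mem _ fun j _ => key i j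

/-- **`span_ℂ [𝔰𝔲(n), M_n(ℂ)] = 𝔰𝔩_n`** — the detected span for the constant gauge transformations with values
in `SU(n)` is exactly the traceless matrices `𝔰𝔩_n = 𝔰𝔲(n)ᶜ`; nothing of the centre `ℂ·1 = 𝔲(1)ᶜ` is detected
(*"by the assumption that 𝔤 is semi-simple, the only element invariant is 0"*). [cite: Balaban1985UV3, (31)–(32) p.264] -/
theorem span_suComm_eq_ker_trace :
    Submodule.span ℂ (suComm n) = LinearMap.ker (Matrix.traceLinearMap n ℂ ℂ) :=
  le_antisymm span_suComm_le_ker_trace fun _ hP => mem_span_suComm_of_trace_eq_zero hP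

/-- Set form of `span_suComm_eq_ker_trace`. [folklore] -/
theorem coe_span_suComm : (Submodule.span ℂ (suComm n) : Set (Matrix n n ℂ)) = {P | Matrix.trace P = 0} := by
  rw [span_suComm_eq_ker_trace]
  ext P
  simp

/-- **Negative control (the centre)**: for `n` non-empty, `1 ∉ span_ℂ [𝔰𝔲(n), M_n(ℂ)]` (`tr 1 = |n| ≠ 0`) — the
`𝔲(1)`-direction of `𝔲(n) = 𝔲(1) ⊕ 𝔰𝔲(n)` is invisible to every conjugation. [folklore] -/
theorem one_not_mem_span_suComm [Nonempty n] : (1 : Matrix n n ℂ) ∉ Submodule.span ℂ (suComm n) := by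
  intro h
  have h0 := span_suComm_le_ker_trace h
  rw [LinearMap.mem_ker, Matrix.traceLinearMap_apply, trace_one] at h0
  exact (Nat.cast_ne_zero.2 Fintype.card_ne_zero) h0

/-- **Negative control (the abelian case, excluded on p. 264)**: for `|n| = 1` (`G = U(1)`, `SU(1) = 1`) NOTHING
is detected — every commutator of `1 × 1` matrices vanishes. [folklore] -/
theorem span_suComm_eq_bot_of_card_eq_one (h1 : Fintype.card n = 1) : Submodule.span ℂ (suComm n) = ⊥ := by
  rw [Submodule.span_eq_bot]
  rintro _ ⟨S, y, -, -, rfl⟩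
  haveI : Unique n := (Fintype.card_eq_one_iff_nonempty_unique.1 h1).some
  have hS : S = Matrix.diagonal fun _ => S default default := by
    ext a b
    rw [Unique.eq_default a, Unique.eq_default b, diagonal_apply_eq]
  have hy : y = Matrix.diagonal fun _ => y default default := by
    ext a b
    rw [Unique.eq_default a, Unique.eq_default b, diagonal_apply_eq]
  rw [hS, hy, diagonal_mul_diagonal, diagonal_mul_diagonal, mul_comm, sub_self]


/-! ### §1c. [folklore] The instance assumptions of `B13DerivZeroGauge` HONEST SCOPE (vii) for `𝔤 = 𝔰𝔲(n)`:
`𝔰𝔲(n) ∩ i𝔰𝔲(n) = 0` and `span_ℂ 𝔰𝔲(n) = 𝔰𝔩_n` inside `M_n(ℂ)` (semisimplicity of `𝔰𝔩_n` itself is NOT proved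
here — Mathlib has no such instance — and is BYPASSED by §1) -/

variable (n) in
/-- `𝔰𝔲(n)` as a subset of `M_n(ℂ)`: skew-Hermitian and traceless. [folklore] -/
def su : Set (Matrix n n ℂ) := {S | star S = -S ∧ Matrix.trace S = 0}

omit [Fintype n] [DecidableEq n] in
/-- `𝔤 ∩ i𝔤 = 0` for `𝔤 ⊆ 𝔲(n)`: a matrix that is skew-Hermitian together with its `i`-multiple vanishes. [folklore] -/
theorem eq_zero_of_skew_of_I_smul_skew {S : Matrix n n ℂ} (hS : star S = -S)
    (hIS : star (Complex.I • S) = -(Complex.I • S)) : S = 0 := by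
  rw [star_smul, hS, Complex.star_def, Complex.conj_I, smul_neg, neg_smul, neg_neg] at hIS
  have h2 : (2 : ℂ) • (Complex.I • S) = 0 := by
    rw [two_smul]
    exact eq_neg_iff_add_eq_zero.1 hIS
  rcases smul_eq_zero.1 h2 with h | h
  · exact absurd h two_ne_zero
  · exact (smul_eq_zero.1 h).resolve_left Complex.I_ne_zero

omit [DecidableEq n] in
/-- `span_ℂ 𝔰𝔲(n) ⊇ 𝔰𝔩_n`: a traceless `P` is `½(P − P⋆) − (i/2)·(i(P + P⋆))` with both `P − P⋆` and `i(P + P⋆)`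
in `𝔰𝔲(n)`. [folklore] -/
theorem mem_span_su_of_trace_eq_zero {P : Matrix n n ℂ} (hP : Matrix.trace P = 0) :
    P ∈ Submodule.span ℂ (su n) := by
  have htr' : Matrix.trace (star P) = 0 := by
    rw [star_eq_conjTranspose, trace_conjTranspose, hP, star_zero]
  have h1 : P - star P ∈ su n :=
    ⟨by rw [star_sub, star_star, neg_sub], by rw [trace_sub, hP, htr', sub_zero]⟩
  have h2 : Complex.I • (P + star P) ∈ su n :=
    ⟨by rw [star_smul, star_add, star_star, Complex.star_def, Complex.conj_I, neg_smul, add_comm],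
      by rw [trace_smul, trace_add, hP, htr', add_zero, smul_zero]⟩
  have hdec : (2 : ℂ)⁻¹ • (P - star P) + (-Complex.I / 2) • (Complex.I • (P + star P)) = P := by
    rw [smul_smul, show -Complex.I / 2 * Complex.I = (2 : ℂ)⁻¹ by
      rw [div_mul_eq_mul_div, neg_mul, Complex.I_mul_I, neg_neg, one_div]]
    module
  rw [← hdec]
  exact Submodule.add_mem _ (Submodule.smul_mem _ _ (Submodule.subset_span h1))
    (Submodule.smul_mem _ _ (Submodule.subset_span h2))

omit [DecidableEq n] in
/-- **`span_ℂ 𝔰𝔲(n) = 𝔰𝔩_n`**: the real form `𝔰𝔲(n)` ℂ-spans the traceless matrices — the hypothesis `hlam` of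
`B13DerivZeroGauge.lieSubalgebra_le_span_comm` / §3 below for `𝔥 = 𝔰𝔩_n` and `λ` ranging over `𝔰𝔲(n)`. [folklore] -/
theorem span_su_eq_ker_trace : Submodule.span ℂ (su n) = LinearMap.ker (Matrix.traceLinearMap n ℂ ℂ) := by
  refine le_antisymm (Submodule.span_le.2 ?_) fun P hP => mem_span_su_of_trace_eq_zero hP
  rintro S ⟨-, hS⟩
  simpa using hS

omit [DecidableEq n] in
/-- `suComm n` is the set of commutators `[S, y]` with `S ∈ su n`. [folklore] -/
theorem suComm_eq : suComm n = {P | ∃ S ∈ su n, ∃ y : Matrix n n ℂ, P = S * y - y * S} := by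
  ext P
  constructor
  · rintro ⟨S, y, hS, hS0, rfl⟩
    exact ⟨S, ⟨hS, hS0⟩, y, rfl⟩
  · rintro ⟨S, ⟨hS, hS0⟩, y, rfl⟩
    exact ⟨S, y, hS, hS0, rfl⟩

end slN

/-! ## §1b. The model's `commSpan M_N(ℂ)` (all of `U(N)`) and `span_ℂ [𝔰𝔲(N), M_N(ℂ)]` (only `SU(N)`) COINCIDE:
both are `𝔰𝔩_N` (operator-norm structure `cstarAlgebraMatrix N` threaded by `letI`, nothing registered) -/

section matrixModel

open scoped Matrix.Norms.L2Operator

/-- `span_ℂ [𝔰𝔲(N), M_N(ℂ)] ⊆ commSpan M_N(ℂ) = span_ℂ [𝔲(N), M_N(ℂ)]` (`𝔰𝔲(N) ⊆ 𝔲(N)`). [folklore] -/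
theorem span_suComm_le_commSpan (N : ℕ) :
    letI := cstarAlgebraMatrix N
    Submodule.span ℂ (suComm (Fin N)) ≤ commSpan (Matrix (Fin N) (Fin N) ℂ) := by
  letI := cstarAlgebraMatrix N
  refine Submodule.span_le.2 ?_
  rintro _ ⟨S, y, hS, -, rfl⟩
  exact Submodule.subset_span ⟨⟨S, skewAdjoint.mem_iff.2 hS⟩, y, rfl⟩

/-- `commSpan M_N(ℂ) ⊆ 𝔰𝔩_N`: a commutator is traceless. [folklore] -/
theorem commSpan_matrix_le_ker_trace (N : ℕ) :
    letI := cstarAlgebraMatrix N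
    commSpan (Matrix (Fin N) (Fin N) ℂ) ≤ LinearMap.ker (Matrix.traceLinearMap (Fin N) ℂ ℂ) := by
  letI := cstarAlgebraMatrix N
  refine Submodule.span_le.2 ?_
  rintro _ ⟨S, y, rfl⟩
  simp [Matrix.trace_mul_comm (S : Matrix (Fin N) (Fin N) ℂ) y]

/-- **`commSpan M_N(ℂ) = span_ℂ [𝔰𝔲(N), M_N(ℂ)]` for every `N`**: the constant gauge transformations with values in
`U(N)` and those with values in `SU(N)` detect THE SAME directions, `𝔰𝔩_N` — generalising `B10Eq31GlobalConj.coe_commSpan_m2`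
(`N = 2`) to all `N`. [cite: Balaban1985UV3, (31)–(32) p.264] -/
theorem commSpan_matrix_eq_span_suComm (N : ℕ) :
    letI := cstarAlgebraMatrix N
    commSpan (Matrix (Fin N) (Fin N) ℂ) = Submodule.span ℂ (suComm (Fin N)) := by
  letI := cstarAlgebraMatrix N
  refine le_antisymm (fun P hP => ?_) (span_suComm_le_commSpan N)
  rw [span_suComm_eq_ker_trace]
  exact commSpan_matrix_le_ker_trace N hP

/-- **THE DETECTED SPAN OF `M_N(ℂ)` IS `𝔰𝔩_N`** (set form, general `N`; `N = 2` is
`B10Eq31GlobalConj.coe_commSpan_m2`). [cite: Balaban1985UV3, (32) p.264] -/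
theorem coe_commSpan_matrix (N : ℕ) :
    letI := cstarAlgebraMatrix N
    (commSpan (Matrix (Fin N) (Fin N) ℂ) : Set (Matrix (Fin N) (Fin N) ℂ)) = {P | Matrix.trace P = 0} := by
  letI := cstarAlgebraMatrix N
  rw [commSpan_matrix_eq_span_suComm N]
  exact coe_span_suComm

/-- The centre is not detected: `1 ∉ commSpan M_N(ℂ)` for `N ≥ 1` (general-`N` form of
`B10Eq61Leaves.example_fderiv_apply_center`). [folklore] -/
theorem one_not_mem_commSpan_matrix (N : ℕ) [NeZero N] :
    letI := cstarAlgebraMatrix N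
    (1 : Matrix (Fin N) (Fin N) ℂ) ∉ commSpan (Matrix (Fin N) (Fin N) ℂ) := by
  letI := cstarAlgebraMatrix N
  rw [commSpan_matrix_eq_span_suComm N]
  exact one_not_mem_span_suComm

/-- The abelian case `N = 1` (`G = U(1)`, excluded on p. 264): `commSpan M₁(ℂ) = 0`, nothing is detected. [folklore] -/
theorem commSpan_matrix_one_eq_bot :
    letI := cstarAlgebraMatrix 1
    commSpan (Matrix (Fin 1) (Fin 1) ℂ) = ⊥ := by
  letI := cstarAlgebraMatrix 1
  rw [commSpan_matrix_eq_span_suComm 1]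
  exact span_suComm_eq_bot_of_card_eq_one (Fintype.card_fin 1)

end matrixModel

/-! ## §2. [folklore] `U(n) = U(1)·SU(n)`: conjugation by a unitary IS conjugation by a special unitary, so
`SU(n)`-class functions are `U(n)`-class functions -/

section unitaryReduction

variable {n : Type*} [Fintype n] [DecidableEq n]

/-- **`U(n) = U(1)·SU(n)` at the level of conjugations**: for `W ∈ U(n)` there is `W′ ∈ SU(n)` (namely `μ̄·W` with
`μ^|n| = det W`, `|μ| = 1`; ℂ algebraically closed) with `W′·V·W′⋆ = W·V·W⋆` for every `V`. [folklore] -/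
theorem exists_specialUnitary_conj_eq {W : Matrix n n ℂ} (hW : W ∈ Matrix.unitaryGroup n ℂ) :
    ∃ W' ∈ Matrix.specialUnitaryGroup n ℂ, ∀ V : Matrix n n ℂ, W' * V * star W' = W * V * star W := by
  rcases isEmpty_or_nonempty n with hn | hn
  · exact ⟨W, Matrix.mem_specialUnitaryGroup_iff.2 ⟨hW, Matrix.det_isEmpty⟩, fun V => rfl⟩
  · have hN : 0 < Fintype.card n := Fintype.card_pos
    obtain ⟨μ, hμ⟩ := IsAlgClosed.exists_pow_nat_eq W.det hN
    have hdet : ‖W.det‖ = 1 := CStarRing.norm_of_mem_unitary (Matrix.det_of_mem_unitary hW)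
    have hμ1 : ‖μ‖ = 1 := by
      rw [← pow_eq_one_iff_of_nonneg (norm_nonneg μ) hN.ne', ← norm_pow, hμ, hdet]
    have hμμ : star μ * μ = 1 := by
      rw [Complex.star_def, mul_comm, Complex.mul_conj, Complex.normSq_eq_norm_sq, hμ1, one_pow,
        Complex.ofReal_one]
    refine ⟨star μ • W, Matrix.mem_specialUnitaryGroup_iff.2 ⟨?_, ?_⟩, fun V => ?_⟩
    · rw [Matrix.mem_unitaryGroup_iff, star_smul, star_star, smul_mul_smul_comm, Matrix.mem_unitaryGroup_iff.1 hW,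
        hμμ, one_smul]
    · rw [Matrix.det_smul, ← hμ, ← mul_pow, hμμ, one_pow]
    · rw [star_smul, star_star, smul_mul_assoc, smul_mul_assoc, mul_smul_comm, smul_smul, hμμ, one_smul]

/-- **`SU(n)`-CLASS FUNCTIONS ARE `U(n)`-CLASS FUNCTIONS**: invariance of a function of bond configurations on any set
`T` under the bondwise conjugations `V ↦ (W·V_b·W⋆)_b` by `W ∈ SU(n)` gives it for all `W ∈ U(n)` — (26) for the
constant gauge transformations with values in `G = SU(n)` is ALL the class-function form of the lineage asks.
[cite: Balaban1985UV3, (26) p.263, (31) p.264] -/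
theorem classFn_of_suClassFn {ι β : Type*} {F : (ι → Matrix n n ℂ) → β} {T : Set (ι → Matrix n n ℂ)}
    (h : ∀ W ∈ Matrix.specialUnitaryGroup n ℂ, ∀ V ∈ T, F (fun b => W * V b * star W) = F V) :
    ∀ W ∈ Matrix.unitaryGroup n ℂ, ∀ V ∈ T, F (fun b => W * V b * star W) = F V := by
  intro W hW V hV
  obtain ⟨W', hW', hconj⟩ := exists_specialUnitary_conj_eq hW
  have hfun : (fun b => W * V b * star W) = fun b => W' * V b * star W' := funext fun b => (hconj (V b)).symm
  rw [hfun]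
  exact h W' hW' V hV

end unitaryReduction

/-! ## §3. THE JOINT THEOREMS IN `G`-FORM for a finite-dimensional complex SEMISIMPLE Lie subalgebra `𝔥 ⊆ 𝔸` (the
realised `𝔤ᶜ`): flows `Ad exp(t·λ_l)` for a family `λ` spanning `𝔥`, generator `𝔥`-valued bond by bond — the
`hcomm` binder supplied by b13's `B13DerivZeroGauge.mem_closure_span_comm_of_mem` (§3b, v1.2) BY NAME -/

section semisimple

-- Mathlib idiom (Mathlib/Algebra/Lie/OfAssociative.lean), exactly as in `B13DerivZeroGauge` §3b: the commutator
-- bracket `⁅a, b⁆ = a * b - b * a`, SECTION-LOCAL instances, nothing registered for importers.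
attribute [local instance 100] LieRing.ofAssociativeRing
attribute [local instance 100] LieAlgebra.ofAssociativeAlgebra

variable {D : LocDomainSys} {ι : Type*} [Fintype ι] {𝔸 : Type*} [CStarAlgebra 𝔸]
  {sp' sp : D.Dom → Set (ι → 𝔸)} {E : D.Dom → (ι → 𝔸) → ℂ} {gen : D.Dom → (ι → 𝔸) → ι → 𝔸}
  {nX : D.Dom → ℕ}

/-- **COMPLEX BACKGROUND, `G`-FORM (semisimple)** — `B10Eq31GlobalConj.logHalfBound_expLine_cplx_of_flowInvariant`
with the commutator binder `hcomm` DISCHARGED from semisimplicity: `𝔥 ⊆ 𝔸` a finite-dimensional complex semisimple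
Lie subalgebra for the commutator bracket (the realised `𝔤ᶜ`, e.g. `𝔰𝔩_N ⊂ M_N(ℂ)`), `λ : Λ → 𝔥` a family spanning
`𝔥` over ℂ (e.g. a basis of the real form `𝔤` — then the flows `Ad exp(tλ_l)` are constant gauge transformations with
values in `G` and `hcl` is (26) for them; for NON-skew `λ_l` the hypothesis `hcl` is `Gᶜ`-invariance, cell GAPS
C-B13-37 reading note), every bond generator `𝔥`-valued (*"The derivative in the above formula is an element of the
Lie algebra 𝔤, and by the assumption that 𝔤 is semi-simple, the only element invariant is 0"*).  Constant
`8·((2p + q)/(min(1/8, a/2) − p))²·B`, rate `r − 2`.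
[cite: Balaban1985UV3, (26), (29) p.263, (31)–(32) p.264, (61) p.271, p.272; Balaban1987RG1, (1.13) p.262, p.283] -/
theorem logHalfBound_expLine_cplx_of_semisimple {B r a p q : ℝ} (hp : 0 ≤ p) (hq : 0 ≤ q) (hpq : 0 < p + q)
    (hpa : p < min (1 / 8) (a / 2)) (hB : 0 ≤ B)
    (hsplit : ∀ X φ, φ ∈ sp' X → ∀ b, ∃ S ∈ skewAdjoint 𝔸,
      ‖S‖ ≤ q * (1 + D.dj X) ∧ ‖gen X φ b - S‖ ≤ p)
    (hsp : ∀ X, TubeCfg ι 𝔸 a ⊆ sp X) (hE : ∀ X, DifferentiableOn ℂ (E X) (sp X))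
    (𝔥 : LieSubalgebra ℂ 𝔸) [FiniteDimensional ℂ 𝔥] [LieAlgebra.IsSemisimple ℂ 𝔥] {Λ : Type*} (lam : Λ → 𝔥)
    (hlam : Submodule.span ℂ (Set.range lam) = ⊤)
    (hcl : ∀ X l (t : ℝ), ∀ V ∈ TubeCfg ι 𝔸 a,
      E X (fun b => exp ((t : ℂ) • (lam l : 𝔸)) * V b * exp ((t : ℂ) • (-(lam l : 𝔸)))) = E X V)
    (hgen : ∀ X φ, φ ∈ sp' X → ∀ b, gen X φ b ∈ 𝔥)
    (hEb : B13.LogHalfBound D sp E nX B r) :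
    B13.LogHalfBound D sp' (diffAlongV E (expLine gen (fun _ _ _ => 1))) nX
      (8 * ((2 * p + q) / (min (1 / 8) (a / 2) - p)) ^ 2 * B) (r - 2) :=
  logHalfBound_expLine_cplx_of_flowInvariant hp hq hpq hpa hB hsplit hsp hE (fun l => (lam l : 𝔸)) hcl
    (B13DerivZeroGauge.mem_closure_span_comm_of_mem 𝔥 lam hlam sp' gen hgen) hEb

/-- **(I.1.18) FOR THE DIFFERENCED (61)-PIECES, `G`-FORM (semisimple)** — [II]'s letters under printed R21,
`α₁ < min(1/8, a/2)`, symmetry data as in `logHalfBound_expLine_cplx_of_semisimple`; constant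
`(64A(1 + c₀²)/(min(1/8, a/2) − α₁)²)·c₁`, rate `r − 3`.
[cite: Balaban1988RG2Cluster, pp.15, 20–21; Balaban1985UV3, (26), (29), (31)–(32) pp.263–264, (61) p.271, p.272; Balaban1987RG1, (1.12)–(1.13) p.262, p.283] -/
theorem bound118_secondOrder_expLine_cplx_of_semisimple (c : B13.Consts) (h21 : c.R21)
    (hLM : 1 ≤ (c.L : ℝ) * c.M) (hα₀ : 0 ≤ c.α₀) (hα₁ : 0 < c.α₁) {A a c₀ r c₁ : ℝ} (hA : 0 ≤ A)
    (hc₀ : 0 ≤ c₀) (hα₁a : c.α₁ < min (1 / 8) (a / 2))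
    (hsplit : ∀ X φ, φ ∈ sp' X → ∀ b, ∃ S ∈ skewAdjoint 𝔸,
      ‖S‖ ≤ c₀ * ((c.L : ℝ) * c.M) * c.α₀ * (1 + D.dj X) ∧ ‖gen X φ b - S‖ ≤ c.α₁)
    (hsp : ∀ X, TubeCfg ι 𝔸 a ⊆ sp X) (hE : ∀ X, DifferentiableOn ℂ (E X) (sp X))
    (𝔥 : LieSubalgebra ℂ 𝔸) [FiniteDimensional ℂ 𝔥] [LieAlgebra.IsSemisimple ℂ 𝔥] {Λ : Type*} (lam : Λ → 𝔥)
    (hlam : Submodule.span ℂ (Set.range lam) = ⊤)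
    (hcl : ∀ X l (t : ℝ), ∀ V ∈ TubeCfg ι 𝔸 a,
      E X (fun b => exp ((t : ℂ) • (lam l : 𝔸)) * V b * exp ((t : ℂ) • (-(lam l : 𝔸)))) = E X V)
    (hgen : ∀ X φ, φ ∈ sp' X → ∀ b, gen X φ b ∈ 𝔥)
    (hEb : B13.LogHalfBound D sp E nX (A * ((c.L : ℝ) * c.M) ^ 4) r) (hvol : B13.VolBoundK1 D nX c₁)
    (hc₁ : 0 ≤ c₁) :
    B13.Bound118 D sp' (diffAlongV E (expLine gen (fun _ _ _ => 1)))
      (64 * A * (1 + c₀ ^ 2) / (min (1 / 8) (a / 2) - c.α₁) ^ 2 * c₁) (r - 3) :=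
  bound118_secondOrder_expLine_cplx_of_flowInvariant c h21 hLM hα₀ hα₁ hA hc₀ hα₁a hsplit hsp hE
    (fun l => (lam l : 𝔸)) hcl (B13DerivZeroGauge.mem_closure_span_comm_of_mem 𝔥 lam hlam sp' gen hgen) hEb
    hvol hc₁

/-- **REAL BACKGROUND, `G`-FORM (semisimple)**: generator skew-adjoint, `𝔥`-valued bond by bond, of norm
`≤ p + q(1 + d(X))`; constant `8((p + q)/a)²·B`, rate `r − 2`.
[cite: Balaban1985UV3, (26), (28)–(29) p.263, (31)–(32) p.264, (61) p.271, p.272] -/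
theorem logHalfBound_expLine_of_semisimple {B r a p q : ℝ} (ha : 0 < a) (hp : 0 ≤ p) (hq : 0 ≤ q)
    (hpq : 0 < p + q) (hB : 0 ≤ B) (hskew : ∀ X φ, φ ∈ sp' X → ∀ b, gen X φ b ∈ skewAdjoint 𝔸)
    (hbound : ∀ X φ, φ ∈ sp' X → ∀ b, ‖gen X φ b‖ ≤ p + q * (1 + D.dj X)) (hsp : ∀ X, TubeCfg ι 𝔸 a ⊆ sp X)
    (hE : ∀ X, DifferentiableOn ℂ (E X) (sp X))
    (𝔥 : LieSubalgebra ℂ 𝔸) [FiniteDimensional ℂ 𝔥] [LieAlgebra.IsSemisimple ℂ 𝔥] {Λ : Type*} (lam : Λ → 𝔥)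
    (hlam : Submodule.span ℂ (Set.range lam) = ⊤)
    (hcl : ∀ X l (t : ℝ), ∀ V ∈ TubeCfg ι 𝔸 a,
      E X (fun b => exp ((t : ℂ) • (lam l : 𝔸)) * V b * exp ((t : ℂ) • (-(lam l : 𝔸)))) = E X V)
    (hgen : ∀ X φ, φ ∈ sp' X → ∀ b, gen X φ b ∈ 𝔥)
    (hEb : B13.LogHalfBound D sp E nX B r) :
    B13.LogHalfBound D sp' (diffAlongV E (expLine gen (fun _ _ _ => 1))) nX (8 * ((p + q) / a) ^ 2 * B)
      (r - 2) :=
  logHalfBound_expLine_of_flowInvariant ha hp hq hpq hB hskew hbound hsp hE (fun l => (lam l : 𝔸)) hcl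
    (B13DerivZeroGauge.mem_closure_span_comm_of_mem 𝔥 lam hlam sp' gen hgen) hEb

end semisimple

/-! ## §4. THE JOINT THEOREMS IN `SU(N)`-FORM over `M_N(ℂ)` (general `N`): (26) for the constant gauge
transformations with values in `SU(N)` (class-function form) or along the one-parameter groups `exp(t𝔰𝔲(N))` (flow
form), and the bond generators TRACELESS -/

section suN

open scoped Matrix.Norms.L2Operator

variable (N : ℕ) {D : LocDomainSys} {ι : Type*} [Fintype ι]
  {sp' sp : D.Dom → Set (ι → Matrix (Fin N) (Fin N) ℂ)} {E : D.Dom → (ι → Matrix (Fin N) (Fin N) ℂ) → ℂ}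
  {gen : D.Dom → (ι → Matrix (Fin N) (Fin N) ℂ) → ι → Matrix (Fin N) (Fin N) ℂ} {nX : D.Dom → ℕ}

omit [Fintype ι] in
/-- Traceless bond generators lie in the closure of the model's detected span `commSpan M_N(ℂ) = 𝔰𝔩_N`. [folklore] -/
theorem mem_closure_commSpan_of_trace_eq_zero
    (htr : ∀ X φ, φ ∈ sp' X → ∀ b, Matrix.trace (gen X φ b) = 0) :
    letI := cstarAlgebraMatrix N
    ∀ X φ, φ ∈ sp' X → ∀ b, gen X φ b ∈ closure (commSpan (Matrix (Fin N) (Fin N) ℂ) : Set _) := by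
  letI := cstarAlgebraMatrix N
  intro X φ hφ b
  refine subset_closure ?_
  rw [coe_commSpan_matrix N]
  exact htr X φ hφ b

omit [Fintype ι] in
/-- Traceless bond generators lie in the closure of `span_ℂ {S·y − y·S : S ∈ 𝔰𝔲(N)}` in the flow theorems' shape
(index type `𝔰𝔲(N)` as a subtype). [folklore] -/
theorem mem_closure_span_suFlow_of_trace_eq_zero [TopologicalSpace (Matrix (Fin N) (Fin N) ℂ)]
    (htr : ∀ X φ, φ ∈ sp' X → ∀ b, Matrix.trace (gen X φ b) = 0) :
    ∀ X φ, φ ∈ sp' X → ∀ b, gen X φ b ∈ closure (Submodule.span ℂ {c : Matrix (Fin N) (Fin N) ℂ | ∃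
      (l : {S : Matrix (Fin N) (Fin N) ℂ // star S = -S ∧ Matrix.trace S = 0}) (y : Matrix (Fin N) (Fin N) ℂ),
      c = (l : Matrix (Fin N) (Fin N) ℂ) * y - y * (l : Matrix (Fin N) (Fin N) ℂ)} : Set _) := by
  intro X φ hφ b
  refine subset_closure (Submodule.span_mono ?_ (mem_span_suComm_of_trace_eq_zero (htr X φ hφ b)))
  rintro _ ⟨S, y, hS, hS0, rfl⟩
  exact ⟨⟨S, hS, hS0⟩, y, rfl⟩

/-- **COMPLEX BACKGROUND, `SU(N)` CLASS-FUNCTION FORM**: every `E X` invariant on the bondwise tube under the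
conjugations by `W ∈ SU(N)` — (26) for the constant gauge transformations with values in `G = SU(N)`, (31) — and
every bond generator TRACELESS (its skew part in `𝔰𝔲(N)`, its complex part in `𝔰𝔩_N = 𝔰𝔲(N)ᶜ`: (27), [I] (1.13),
p. 283).  By §2 the `SU(N)`-class function is a `U(N)`-class function and by §1 the traceless generator lies in
`commSpan M_N(ℂ) = 𝔰𝔩_N`, so `B10Eq31GlobalConj.logHalfBound_expLine_cplx_of_classFn` applies.  Constant
`8·((2p + q)/(min(1/8, a/2) − p))²·B`, rate `r − 2`.
[cite: Balaban1985UV3, (26)–(27), (29) p.263, (31)–(32) p.264, (61) p.271, p.272; Balaban1987RG1, (1.13) p.262, p.283] -/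
theorem logHalfBound_expLine_cplx_of_suClassFn {B r a p q : ℝ} (hp : 0 ≤ p) (hq : 0 ≤ q) (hpq : 0 < p + q)
    (hpa : p < min (1 / 8) (a / 2)) (hB : 0 ≤ B) :
    letI := cstarAlgebraMatrix N
    ∀ (_hsplit : ∀ X φ, φ ∈ sp' X → ∀ b, ∃ S ∈ skewAdjoint (Matrix (Fin N) (Fin N) ℂ),
        ‖S‖ ≤ q * (1 + D.dj X) ∧ ‖gen X φ b - S‖ ≤ p)
      (_hsp : ∀ X, TubeCfg ι (Matrix (Fin N) (Fin N) ℂ) a ⊆ sp X) (_hE : ∀ X, DifferentiableOn ℂ (E X) (sp X))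
      (_hcls : ∀ X, ∀ W ∈ Matrix.specialUnitaryGroup (Fin N) ℂ, ∀ V ∈ TubeCfg ι (Matrix (Fin N) (Fin N) ℂ) a,
        E X (fun b => W * V b * star W) = E X V)
      (_htr : ∀ X φ, φ ∈ sp' X → ∀ b, Matrix.trace (gen X φ b) = 0)
      (_hEb : B13.LogHalfBound D sp E nX B r),
    B13.LogHalfBound D sp' (diffAlongV E (expLine gen (fun _ _ _ => 1))) nX
      (8 * ((2 * p + q) / (min (1 / 8) (a / 2) - p)) ^ 2 * B) (r - 2) := by
  letI := cstarAlgebraMatrix N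
  intro hsplit hsp hE hcls htr hEb
  exact logHalfBound_expLine_cplx_of_classFn hp hq hpq hpa hB hsplit hsp hE (fun X => classFn_of_suClassFn (hcls X))
    (mem_closure_commSpan_of_trace_eq_zero N htr) hEb

/-- **COMPLEX BACKGROUND, `SU(N)` FLOW FORM**: every `E X` invariant on the bondwise tube under the conjugations by
`exp(tS)`, `S ∈ 𝔰𝔲(N)` (skew-Hermitian and traceless), `t` real — the one-parameter subgroups of the constant
`SU(N)`-valued gauge transformations — and every bond generator traceless (§1: in `span_ℂ [𝔰𝔲(N), M_N(ℂ)] = 𝔰𝔩_N`).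
Constant `8·((2p + q)/(min(1/8, a/2) − p))²·B`, rate `r − 2`.
[cite: Balaban1985UV3, (26)–(27), (29) p.263, (31)–(32) p.264, (61) p.271, p.272; Balaban1987RG1, (1.13) p.262, p.283] -/
theorem logHalfBound_expLine_cplx_of_suFlowInvariant {B r a p q : ℝ} (hp : 0 ≤ p) (hq : 0 ≤ q) (hpq : 0 < p + q)
    (hpa : p < min (1 / 8) (a / 2)) (hB : 0 ≤ B) :
    letI := cstarAlgebraMatrix N
    ∀ (_hsplit : ∀ X φ, φ ∈ sp' X → ∀ b, ∃ S ∈ skewAdjoint (Matrix (Fin N) (Fin N) ℂ),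
        ‖S‖ ≤ q * (1 + D.dj X) ∧ ‖gen X φ b - S‖ ≤ p)
      (_hsp : ∀ X, TubeCfg ι (Matrix (Fin N) (Fin N) ℂ) a ⊆ sp X) (_hE : ∀ X, DifferentiableOn ℂ (E X) (sp X))
      (_hcl : ∀ X (S : Matrix (Fin N) (Fin N) ℂ), star S = -S → Matrix.trace S = 0 → ∀ (t : ℝ),
        ∀ V ∈ TubeCfg ι (Matrix (Fin N) (Fin N) ℂ) a,
        E X (fun b => exp ((t : ℂ) • S) * V b * exp ((t : ℂ) • (-S))) = E X V)
      (_htr : ∀ X φ, φ ∈ sp' X → ∀ b, Matrix.trace (gen X φ b) = 0)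
      (_hEb : B13.LogHalfBound D sp E nX B r),
    B13.LogHalfBound D sp' (diffAlongV E (expLine gen (fun _ _ _ => 1))) nX
      (8 * ((2 * p + q) / (min (1 / 8) (a / 2) - p)) ^ 2 * B) (r - 2) := by
  letI := cstarAlgebraMatrix N
  intro hsplit hsp hE hcl htr hEb
  exact logHalfBound_expLine_cplx_of_flowInvariant hp hq hpq hpa hB hsplit hsp hE
    (fun l : {S : Matrix (Fin N) (Fin N) ℂ // star S = -S ∧ Matrix.trace S = 0} => (l : Matrix (Fin N) (Fin N) ℂ))
    (fun X l t V hV => hcl X l.1 l.2.1 l.2.2 t V hV) (mem_closure_span_suFlow_of_trace_eq_zero N htr) hEb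

/-- **(I.1.18) FOR THE DIFFERENCED (61)-PIECES ALONG COMPLEX BACKGROUNDS, `SU(N)` CLASS-FUNCTION FORM** ([II]'s
letters, printed R21, `α₁ < min(1/8, a/2)`): constant `(64A(1 + c₀²)/(min(1/8, a/2) − α₁)²)·c₁`, rate `r − 3`.
[cite: Balaban1988RG2Cluster, pp.15, 20–21; Balaban1985UV3, (26)–(27), (29), (31)–(32) pp.263–264, (61) p.271, p.272; Balaban1987RG1, (1.12)–(1.13) p.262, p.283] -/
theorem bound118_secondOrder_expLine_cplx_of_suClassFn (c : B13.Consts) (h21 : c.R21)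
    (hLM : 1 ≤ (c.L : ℝ) * c.M) (hα₀ : 0 ≤ c.α₀) (hα₁ : 0 < c.α₁) {A a c₀ r c₁ : ℝ} (hA : 0 ≤ A)
    (hc₀ : 0 ≤ c₀) (hα₁a : c.α₁ < min (1 / 8) (a / 2)) :
    letI := cstarAlgebraMatrix N
    ∀ (_hsplit : ∀ X φ, φ ∈ sp' X → ∀ b, ∃ S ∈ skewAdjoint (Matrix (Fin N) (Fin N) ℂ),
        ‖S‖ ≤ c₀ * ((c.L : ℝ) * c.M) * c.α₀ * (1 + D.dj X) ∧ ‖gen X φ b - S‖ ≤ c.α₁)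
      (_hsp : ∀ X, TubeCfg ι (Matrix (Fin N) (Fin N) ℂ) a ⊆ sp X) (_hE : ∀ X, DifferentiableOn ℂ (E X) (sp X))
      (_hcls : ∀ X, ∀ W ∈ Matrix.specialUnitaryGroup (Fin N) ℂ, ∀ V ∈ TubeCfg ι (Matrix (Fin N) (Fin N) ℂ) a,
        E X (fun b => W * V b * star W) = E X V)
      (_htr : ∀ X φ, φ ∈ sp' X → ∀ b, Matrix.trace (gen X φ b) = 0)
      (_hEb : B13.LogHalfBound D sp E nX (A * ((c.L : ℝ) * c.M) ^ 4) r) (_hvol : B13.VolBoundK1 D nX c₁)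
      (_hc₁ : 0 ≤ c₁),
    B13.Bound118 D sp' (diffAlongV E (expLine gen (fun _ _ _ => 1)))
      (64 * A * (1 + c₀ ^ 2) / (min (1 / 8) (a / 2) - c.α₁) ^ 2 * c₁) (r - 3) := by
  letI := cstarAlgebraMatrix N
  intro hsplit hsp hE hcls htr hEb hvol hc₁
  exact bound118_secondOrder_expLine_cplx_of_classFn c h21 hLM hα₀ hα₁ hA hc₀ hα₁a hsplit hsp hE
    (fun X => classFn_of_suClassFn (hcls X)) (mem_closure_commSpan_of_trace_eq_zero N htr) hEb hvol hc₁

/-- **REAL BACKGROUND, `SU(N)` CLASS-FUNCTION FORM**: generator in `𝔰𝔲(N)` bond by bond (skew-Hermitian, traceless: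
(27)) of norm `≤ p + q(1 + d(X))`, `E X` an `SU(N)`-class function on the bondwise tube of half-width `a ⊆ sp X`,
holomorphic on `sp X`; constant `8((p + q)/a)²·B`, rate `r − 2`.
[cite: Balaban1985UV3, (26)–(28), (29) p.263, (31)–(32) p.264, (61) p.271, p.272] -/
theorem logHalfBound_expLine_of_suClassFn {B r a p q : ℝ} (ha : 0 < a) (hp : 0 ≤ p) (hq : 0 ≤ q)
    (hpq : 0 < p + q) (hB : 0 ≤ B) :
    letI := cstarAlgebraMatrix N
    ∀ (_hskew : ∀ X φ, φ ∈ sp' X → ∀ b, gen X φ b ∈ skewAdjoint (Matrix (Fin N) (Fin N) ℂ))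
      (_hbound : ∀ X φ, φ ∈ sp' X → ∀ b, ‖gen X φ b‖ ≤ p + q * (1 + D.dj X))
      (_hsp : ∀ X, TubeCfg ι (Matrix (Fin N) (Fin N) ℂ) a ⊆ sp X) (_hE : ∀ X, DifferentiableOn ℂ (E X) (sp X))
      (_hcls : ∀ X, ∀ W ∈ Matrix.specialUnitaryGroup (Fin N) ℂ, ∀ V ∈ TubeCfg ι (Matrix (Fin N) (Fin N) ℂ) a,
        E X (fun b => W * V b * star W) = E X V)
      (_htr : ∀ X φ, φ ∈ sp' X → ∀ b, Matrix.trace (gen X φ b) = 0)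
      (_hEb : B13.LogHalfBound D sp E nX B r),
    B13.LogHalfBound D sp' (diffAlongV E (expLine gen (fun _ _ _ => 1))) nX (8 * ((p + q) / a) ^ 2 * B)
      (r - 2) := by
  letI := cstarAlgebraMatrix N
  intro hskew hbound hsp hE hcls htr hEb
  exact logHalfBound_expLine_of_classFn ha hp hq hpq hB hskew hbound hsp hE
    (fun X => classFn_of_suClassFn (hcls X)) (mem_closure_commSpan_of_trace_eq_zero N htr) hEb

end suN

/-! ## §5. A TRUE `B13.Consts` R21-instance: every binder of `bound118_secondOrder_expLine_cplx_of_suClassFn`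
DERIVED over `M₂(ℂ)`, `G = SU(2)`, with R21 holding (with equality), and the differenced family `= −4 ≠ 0` -/

section r21Example

open scoped Matrix.Norms.L2Operator

open B10Eq61Leaves (M₂ trCLM trCLM_apply mA mC mK mK_eq mK_mem_skewAdjoint mK_ne_zero m2E differentiable_m2E
  example_logHalfBound_m2E)
open B10Eq31GlobalConj (exp_mK_add_smul_mA norm_mA_le m2E_conj)

/-- MODEL VALUES of [II]'s letters with the printed restriction R21 TRUE (with equality): `L = 13`, `M = 2` (so
`LM = 26`, `(LM)⁴ = 456976`) and `α₀ = α₁ = α₄ = γ₂ = (LM)⁻⁴`; the letters not read by the theorem are set to `0`.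
The numbers are the model's, chosen only to make R21 hold; NO other printed restriction on [II]'s constants is
claimed for them. [folklore] -/
def r21Consts : B13.Consts where
  L := 13
  q := 0
  M := 2
  κ := 0
  κ₁ := 0
  δ := 0
  δ₀ := 0
  E₀ := 0
  ε₁ := 0
  C₁ := 0
  C₂ := 0
  C₃ := 0
  α₀ := 1 / 456976
  α₁ := 1 / 456976
  α₄ := 1 / 456976
  α₅ := 0
  α₆ := 0
  γ₂ := 1 / 456976
  γ := 0
  A₁ := 0
  A₂ := 0

/-- `LM = 26`. [folklore] -/
theorem r21Consts_LM : (r21Consts.L : ℝ) * r21Consts.M = 26 := by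
  norm_num [r21Consts]

/-- **R21 HOLDS** for `r21Consts`: `(LM)⁴α₀ = (LM)⁴α₁ = (LM)⁴α₄ = (LM)⁴γ₂ = 1 ≤ 1`.
[cite: Balaban1988RG2Cluster, p.20 (before the definition of C₃)] -/
theorem r21Consts_R21 : r21Consts.R21 := by
  simp only [B13.Consts.R21, r21Consts]
  norm_num

/-- The example generator with the complex part of size EXACTLY `α₁`: `K + α₁·E₁₂` (`K = iπ(E₁₁ − E₂₂) ∈ 𝔰𝔲(2)`,
`E₁₂ ∈ 𝔰𝔩₂` nilpotent, not skew, not commuting with `K`). [folklore] -/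
def m2GenR (_X : unitSys.Dom) (_φ : Unit → M₂) (_b : Unit) : M₂ := mK + (456976 : ℂ)⁻¹ • mA

/-- `tr K = 0` (`K = [A, C]`). [folklore] -/
theorem trace_mK : Matrix.trace mK = 0 := by
  show Matrix.trace (mA * mC - mC * mA) = 0
  rw [Matrix.trace_sub, Matrix.trace_mul_comm, sub_self]

/-- `tr E₁₂ = 0`. [folklore] -/
theorem trace_mA : Matrix.trace mA = 0 := by
  simp [mA, Matrix.trace_fin_two]

/-- The example generator is traceless bond by bond (`𝔰𝔩₂`-valued). [folklore] -/
theorem trace_m2GenR (X : unitSys.Dom) (φ : Unit → M₂) (b : Unit) : Matrix.trace (m2GenR X φ b) = 0 := by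
  rw [m2GenR, Matrix.trace_add, Matrix.trace_smul, trace_mK, trace_mA, smul_zero, add_zero]

/-- The split binder in [II]'s letters: within `α₁` of the skew element `K`, whose norm is
`≤ c₀·(LM)·α₀·(1 + d(X))` with `c₀ = ‖K‖·(LM)³` (the model's real part is `O(1)`, so the letters force a large `c₀`;
the theorem leaves `c₀` free). [folklore] -/
theorem m2GenR_split (X : unitSys.Dom) (φ : Unit → M₂) (b : Unit) :
    letI := cstarAlgebraMatrix 2
    ∃ S ∈ skewAdjoint M₂, ‖S‖ ≤ ‖mK‖ * 26 ^ 3 * ((r21Consts.L : ℝ) * r21Consts.M) * r21Consts.α₀ *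
      (1 + unitSys.dj X) ∧ ‖m2GenR X φ b - S‖ ≤ r21Consts.α₁ := by
  letI := cstarAlgebraMatrix 2
  refine ⟨mK, mK_mem_skewAdjoint, ?_, ?_⟩
  · have h : ‖mK‖ * 26 ^ 3 * ((r21Consts.L : ℝ) * r21Consts.M) * r21Consts.α₀ * (1 + unitSys.dj X) = ‖mK‖ := by
      simp only [r21Consts, unitSys, Nat.cast_ofNat]
      ring
    rw [h]
  · have h : m2GenR X φ b - mK = (456976 : ℂ)⁻¹ • mA := by simp [m2GenR]
    have h1 : ‖(456976 : ℂ)‖ = 456976 := by simp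
    rw [h, norm_smul, norm_inv, h1]
    have := norm_mA_le
    simp only [r21Consts]
    linarith [inv_mul_le_iff₀ (show (0 : ℝ) < 456976 by norm_num) |>.2
      (by linarith : ‖mA‖ ≤ 456976 * (1 / 456976))]

/-- `tr` is an `SU(2)`-class function on everything (a fortiori on the tube). [cite: Balaban1985UV3, (26) p.263, (31) p.264] -/
theorem m2E_suClassFn (X : unitSys.Dom) {W : M₂} (hW : W ∈ Matrix.specialUnitaryGroup (Fin 2) ℂ)
    (V : Unit → M₂) : m2E X (fun b => W * V b * star W) = m2E X V :=
  m2E_conj X (Matrix.specialUnitaryGroup_le_unitaryGroup hW) V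

/-- **JOINT NON-VACUITY OF THE [II]-LETTER THEOREM WITH R21 TRUE**: every binder of
`bound118_secondOrder_expLine_cplx_of_suClassFn` holds for the `M₂(ℂ)` data — `c = r21Consts` (R21 with
equality, `LM = 26`), `A = 3‖tr‖/(LM)⁴` (so that `A(LM)⁴ = 3‖tr‖` is `B10Eq61Leaves.example_logHalfBound_m2E`),
tube half-width `a = 1`, `c₀ = ‖K‖(LM)³`, `r = 0`, `c₁ = 1`, evaluation space = everything, generator
`K + α₁E₁₂` traceless, `tr` an `SU(2)`-class function — giving the (I.1.18)-shaped differenced bound with constant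
`64·(3‖tr‖/26⁴)·(1 + (‖K‖·26³)²)/(min(1/8, 1/2) − 26⁻⁴)²·1` and rate `0 − 3`. [folklore] -/
theorem example_bound118_expLine_cplx_m2_R21 :
    letI := cstarAlgebraMatrix 2
    B13.Bound118 unitSys (fun _ => univ) (diffAlongV m2E (expLine m2GenR (fun _ _ _ => 1)))
      (64 * (3 * ‖trCLM‖ / 26 ^ 4) * (1 + (‖mK‖ * 26 ^ 3) ^ 2) / (min (1 / 8) (1 / 2) - 1 / 456976) ^ 2 * 1)
      (0 - 3) := by
  letI := cstarAlgebraMatrix 2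
  have hEb : B13.LogHalfBound unitSys (fun _ => TubeCfg Unit M₂ 1) m2E (fun _ => 1)
      (3 * ‖trCLM‖ / 26 ^ 4 * ((r21Consts.L : ℝ) * r21Consts.M) ^ 4) 0 := by
    rw [r21Consts_LM]
    have h : 3 * ‖trCLM‖ / 26 ^ 4 * (26 : ℝ) ^ 4 = 3 * ‖trCLM‖ := by
      field_simp
    rw [h]
    exact example_logHalfBound_m2E
  have h := bound118_secondOrder_expLine_cplx_of_suClassFn 2 (sp' := fun _ => univ)
    (sp := fun _ => TubeCfg Unit M₂ 1) (E := m2E) (gen := m2GenR) (nX := fun _ => 1) r21Consts r21Consts_R21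
    (by rw [r21Consts_LM]; norm_num) (by norm_num [r21Consts]) (by norm_num [r21Consts])
    (A := 3 * ‖trCLM‖ / 26 ^ 4) (a := 1) (c₀ := ‖mK‖ * 26 ^ 3) (r := 0) (c₁ := 1) (by positivity) (by positivity)
    (by simp only [r21Consts]; norm_num) (fun X φ _ b => m2GenR_split X φ b) (fun _ => Subset.rfl)
    (fun X => (differentiable_m2E X).differentiableOn) (fun X W hW V _ => m2E_suClassFn X hW V)
    (fun X φ _ b => trace_m2GenR X φ b) hEb (fun X => show ((1 : ℕ) : ℝ) ≤ 1 * (1 + 0) by norm_num) zero_le_one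
  have e : r21Consts.α₁ = 1 / 456976 := rfl
  rw [e] at h
  exact h

/-- **…and non-degenerately**: the differenced family at the configuration `1` is `tr exp(K + α₁E₁₂) − tr 1 = −4 ≠ 0`
(`B10Eq31GlobalConj.exp_mK_add_smul_mA`: `exp(K + cE₁₂) = −1` for every `c`). [folklore] -/
theorem example_diffAlongV_m2_R21 (X : unitSys.Dom) :
    letI := cstarAlgebraMatrix 2
    diffAlongV m2E (expLine m2GenR (fun _ _ _ => 1)) X (fun _ => 1) = -4 := by
  letI := cstarAlgebraMatrix 2
  simp only [diffAlongV, expLine, m2E, m2GenR, one_smul, zero_smul, exp_zero, mul_one, trCLM_apply,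
    exp_mK_add_smul_mA, Matrix.trace_neg, Matrix.trace_one, Fintype.card_fin]
  norm_num

end r21Example

end Literature.MathematicalPhysics.QuantumFieldTheory.Balaban1983to89.B10Eq32SuN
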